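import Mathlib
import Summits.Ventures.PercRepro2.SwOutAll
import Summits.Ventures.PercRepro2.SwAllLeafMarkDefs

/-!
# THE MARK WITH NEIGHBOURS `p` AND `h` ONLY, I: the isolated graph and the cluster transport
(blind cell PercRepro2, night-4 g30, 2026-08-28; proofs/NIGHT4-G30.md)

`x` is an H-MARK vertex relative to `p` when every edge at `x` joins `x` to `p` or to `h`
(`IsHMarkAt`; any multiplicities, no loop at `x`; a leaf at `p` has no edge to `h`).  The ISOLATED
graph `isolate ends x` deletes the edges at `x` (loops at `x`, same edge type).  On the side
`Q_x = {h ∉ H_l, x ∈ C_R(l) ∖ C_B(l)}` every edge `x–h` is blue (a red one puts `h` into `C_R(l)`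
through `x`), some edge `x–p` is red with `p` in the red cluster of `l` of the isolated graph, and
`p ∈ C_B(l)` forces every edge `x–p` red (`IsHMarkAt.mem_tgt_iff`).  Tools: `cluster_isolate_subset`,
`x_notMem_cluster_isolate`, the CLUSTER TRANSPORT for a root whose cluster avoids `h`
(`IsHMarkAt.cluster_transport`: away from `x` the two graphs have the same cluster, and `x` is in
the cluster iff a red edge `x–p` has `p` in it), its converse (`IsHMarkAt.h_notMem_cluster_of_isolate`),
the red edge set of `h` on `Q_x` (`IsHMarkAt.redEdges_eq`), the blue one (`blueEdges_isolate_subset`).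
Theorem (`IsHMarkAt.swAll_hMark`, next file): row 2′SW-ALL with the mark at `x` follows from the
row with the mark at `p` on the isolated graph.
-/

namespace Summit.Ventures.PercRepro2

namespace LocRows

open Hull

variable {V : Type*} {E : Type*}

open scoped Classical

/-- The graph with every edge at `x` deleted: those edges become loops at `x`. -/
noncomputable def isolate (ends : E → Sym2 V) (x : V) : E → Sym2 V :=
  fun e => if x ∈ ends e then s(x, x) else ends e

/-- `x` is an H-MARK vertex relative to `p`: every edge at `x` joins `x` to `p` or to `h`. -/
structure IsHMarkAt (ends : E → Sym2 V) (x p h : V) : Prop where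
  xp : x ≠ p
  xh : x ≠ h
  edges : ∀ e, x ∈ ends e → ends e = s(x, p) ∨ ends e = s(x, h)

variable {ends : E → Sym2 V} {x : V}

/-- An edge at `x` is a loop at `x` in the isolated graph. -/
lemma isolate_apply_of_mem {e : E} (he : x ∈ ends e) : isolate ends x e = s(x, x) := by
  simp only [isolate, if_pos he]

/-- The other edges are unchanged. -/
lemma isolate_apply_of_notMem {e : E} (he : x ∉ ends e) : isolate ends x e = ends e := by
  simp only [isolate, if_neg he]

/-- A non-loop edge of the isolated graph avoids `x` and is the same edge of the graph. -/
lemma ends_eq_of_isolate_eq {e : E} {a b : V} (hab : a ≠ b) (h : isolate ends x e = s(a, b)) :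
    x ∉ ends e ∧ ends e = s(a, b) := by
  by_cases hx : x ∈ ends e
  · rw [isolate_apply_of_mem hx, Sym2.eq_iff] at h
    exfalso
    rcases h with ⟨h1, h2⟩ | ⟨h1, h2⟩
    · exact hab (h1.symm.trans h2)
    · exact hab (h2.symm.trans h1)
  · rw [isolate_apply_of_notMem hx] at h
    exact ⟨hx, h⟩

/-- An edge avoiding `x` is the same edge of the isolated graph (the converse reading). -/
lemma isolate_eq_of_ends_eq {e : E} {a b : V} (ha : a ≠ x) (hb : b ≠ x) (h : ends e = s(a, b)) :
    isolate ends x e = s(a, b) := by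
  have hx : x ∉ ends e := by
    rw [h, Sym2.mem_iff, not_or]
    exact ⟨ha.symm, hb.symm⟩
  rw [isolate_apply_of_notMem hx, h]

/-- The clusters of the isolated graph lie inside the clusters of the graph. -/
lemma cluster_isolate_subset (ζ : Config E) (v : V) :
    cluster (isolate ends x) ζ v ⊆ cluster ends ζ v := by
  intro w hw
  refine mem_of_conn_of_closed (ends := isolate ends x) (ω := ζ) ?_ (mem_cluster_self ends ζ v) hw
  intro a ha b hab
  obtain ⟨hne, e, he, hends⟩ := openGraph_adj.1 hab
  obtain ⟨-, hends'⟩ := ends_eq_of_isolate_eq hne hends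
  exact mem_cluster_of_edge ha he hends'

/-- `x` is isolated in the isolated graph: it lies in no cluster of another vertex. -/
lemma x_notMem_cluster_isolate {ζ : Config E} {v : V} (hv : v ≠ x) :
    x ∉ cluster (isolate ends x) ζ v := by
  intro hx
  have key : x ∈ {y | y ≠ x} := by
    refine mem_of_conn_of_closed (ends := isolate ends x) (ω := ζ) ?_ hv hx
    intro a ha b hab hbx
    obtain ⟨hne, e, he, hends⟩ := openGraph_adj.1 hab
    rw [hbx] at hne hends
    obtain ⟨hx', hends'⟩ := ends_eq_of_isolate_eq hne hends
    exact hx' (by rw [hends']; exact Sym2.mem_mk_right _ _)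
  exact key rfl

/-- Two configurations agreeing off the edges at `x` have the same open graph in the isolated
graph. -/
lemma openGraph_isolate_eq_of_agree {ζ ζ' : Config E} (hag : ∀ e, x ∉ ends e → ζ' e = ζ e) :
    openGraph (isolate ends x) ζ' = openGraph (isolate ends x) ζ := by
  ext a b
  rw [openGraph_adj, openGraph_adj]
  constructor
  · rintro ⟨hne, e, he, hends⟩
    obtain ⟨hx, -⟩ := ends_eq_of_isolate_eq hne hends
    exact ⟨hne, e, by rw [← hag e hx]; exact he, hends⟩
  · rintro ⟨hne, e, he, hends⟩
    obtain ⟨hx, -⟩ := ends_eq_of_isolate_eq hne hends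
    exact ⟨hne, e, by rw [hag e hx]; exact he, hends⟩

/-- Two configurations agreeing off the edges at `x` have the same clusters in the isolated graph. -/
lemma cluster_isolate_eq_of_agree {ζ ζ' : Config E} (hag : ∀ e, x ∉ ends e → ζ' e = ζ e) (v : V) :
    cluster (isolate ends x) ζ' v = cluster (isolate ends x) ζ v := by
  ext w
  simp only [mem_cluster, Conn, openGraph_isolate_eq_of_agree hag]

/-- An edge inside a vertex set avoiding `x` is inside it in the isolated graph, and conversely. -/
lemma within_isolate_eq {S : Set V} (hx : x ∉ S) : within (isolate ends x) S = within ends S := by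
  ext e
  constructor
  · rintro ⟨a, ha, b, hb, hab⟩
    have hax : a ≠ x := fun h => hx (h ▸ ha)
    have hbx : b ≠ x := fun h => hx (h ▸ hb)
    by_cases hab' : a = b
    · subst hab'
      by_cases hxe : x ∈ ends e
      · rw [isolate_apply_of_mem hxe, Sym2.eq_iff] at hab
        rcases hab with ⟨h1, -⟩ | ⟨h1, -⟩ <;> exact absurd h1.symm hax
      · rw [isolate_apply_of_notMem hxe] at hab
        exact ⟨a, ha, a, ha, hab⟩
    · obtain ⟨-, hends⟩ := ends_eq_of_isolate_eq hab' hab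
      exact ⟨a, ha, b, hb, hends⟩
  · rintro ⟨a, ha, b, hb, hab⟩
    have hax : a ≠ x := fun h => hx (h ▸ ha)
    have hbx : b ≠ x := fun h => hx (h ▸ hb)
    exact ⟨a, ha, b, hb, isolate_eq_of_ends_eq hax hbx hab⟩

/-- The red edge set of `h` of the isolated graph lies in that of the graph. -/
lemma redEdges_isolate_subset {ζ : Config E} {h : V} (hh : h ≠ x) :
    redEdges (isolate ends x) ζ h ⊆ redEdges ends ζ h := by
  rintro e ⟨he, hin⟩
  refine ⟨he, ?_⟩
  rw [within_isolate_eq (x_notMem_cluster_isolate hh)] at hin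
  obtain ⟨a, ha, b, hb, hab⟩ := hin
  exact ⟨a, cluster_isolate_subset ζ h ha, b, cluster_isolate_subset ζ h hb, hab⟩

/-- The blue edge set of `h` of the isolated graph lies in that of the graph. -/
lemma blueEdges_isolate_subset {ζ : Config E} {h : V} (hh : h ≠ x) :
    blueEdges (isolate ends x) ζ h ⊆ blueEdges ends ζ h :=
  redEdges_isolate_subset hh

/-- The red edge set of `h` in the isolated graph is determined by the bits off the edges at
`x`. -/
lemma redEdges_isolate_eq_of_agree {ζ ζ' : Config E} {h : V} (hh : h ≠ x)
    (hag : ∀ e, x ∉ ends e → ζ' e = ζ e) :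
    redEdges (isolate ends x) ζ' h = redEdges (isolate ends x) ζ h := by
  ext e
  simp only [mem_redEdges, cluster_isolate_eq_of_agree hag]
  rw [within_isolate_eq (x_notMem_cluster_isolate hh)]
  constructor
  · rintro ⟨he, a, ha, b, hb, hab⟩
    have hx : x ∉ ends e := by
      rw [hab, Sym2.mem_iff, not_or]
      exact ⟨fun h' => x_notMem_cluster_isolate hh (by rwa [← h'] at ha),
        fun h' => x_notMem_cluster_isolate hh (by rwa [← h'] at hb)⟩
    exact ⟨by rw [← hag e hx]; exact he, a, ha, b, hb, hab⟩
  · rintro ⟨he, a, ha, b, hb, hab⟩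
    have hx : x ∉ ends e := by
      rw [hab, Sym2.mem_iff, not_or]
      exact ⟨fun h' => x_notMem_cluster_isolate hh (by rwa [← h'] at ha),
        fun h' => x_notMem_cluster_isolate hh (by rwa [← h'] at hb)⟩
    exact ⟨by rw [hag e hx]; exact he, a, ha, b, hb, hab⟩

/-- The blue edge set of `h` in the isolated graph is determined by the bits off the edges at
`x`. -/
lemma blueEdges_isolate_eq_of_agree {ζ ζ' : Config E} {h : V} (hh : h ≠ x)
    (hag : ∀ e, x ∉ ends e → ζ' e = ζ e) :
    blueEdges (isolate ends x) ζ' h = blueEdges (isolate ends x) ζ h :=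
  redEdges_isolate_eq_of_agree hh fun e he => by simp only [blue_apply, hag e he]

/-- If `x` is not in the cluster of `v`, the cluster is that of the isolated graph. -/
lemma cluster_eq_isolate_of_notMem {ζ : Config E} {v : V}
    (hx : x ∉ cluster ends ζ v) : cluster ends ζ v = cluster (isolate ends x) ζ v := by
  refine Set.Subset.antisymm ?_ (cluster_isolate_subset ζ v)
  intro w hw
  have key : w ∈ {y | y ∈ cluster ends ζ v ∧ (y ≠ x → y ∈ cluster (isolate ends x) ζ v)} := by
    refine mem_of_conn_of_closed (ends := ends) (ω := ζ) ?_
      ⟨mem_cluster_self _ _ _, fun _ => mem_cluster_self _ _ _⟩ hw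
    rintro a ⟨ha, ha'⟩ b hab
    obtain ⟨hne, e, he, hends⟩ := openGraph_adj.1 hab
    refine ⟨mem_cluster_of_edge ha he hends, fun hbx => ?_⟩
    have hax : a ≠ x := fun h' => hx (h' ▸ ha)
    exact mem_cluster_of_edge (ha' hax) he (isolate_eq_of_ends_eq hax hbx hends)
  exact key.2 fun h' => hx (h' ▸ hw)

section HMark

variable {p h : V} (hm : IsHMarkAt ends x p h)
include hm

/-- **Cluster transport** for a root `v ≠ x` whose cluster avoids `h`: away from `x` the clusters
of the graph and of the isolated graph agree, and `x` is in the cluster iff some red edge `x–p`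
has `p` in the cluster of the isolated graph. -/
lemma IsHMarkAt.cluster_transport {ζ : Config E} {v : V} (hv : v ≠ x)
    (hh : h ∉ cluster ends ζ v) :
    (∀ w, w ≠ x → (w ∈ cluster ends ζ v ↔ w ∈ cluster (isolate ends x) ζ v)) ∧
    (x ∈ cluster ends ζ v ↔
      ∃ e, ends e = s(x, p) ∧ ζ e = true ∧ p ∈ cluster (isolate ends x) ζ v) := by
  have hS : cluster ends ζ v ⊆ {y | y ∈ cluster ends ζ v ∧
      ((y ≠ x ∧ y ∈ cluster (isolate ends x) ζ v) ∨
        (y = x ∧ ∃ e, ends e = s(x, p) ∧ ζ e = true ∧ p ∈ cluster (isolate ends x) ζ v))} := by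
    intro y hy
    refine mem_of_conn_of_closed (ends := ends) (ω := ζ) ?_
      ⟨mem_cluster_self _ _ _, Or.inl ⟨hv, mem_cluster_self _ _ _⟩⟩ hy
    rintro a ⟨ha, ha'⟩ b hab
    obtain ⟨hne, e, he, hends⟩ := openGraph_adj.1 hab
    have hb : b ∈ cluster ends ζ v := mem_cluster_of_edge ha he hends
    refine ⟨hb, ?_⟩
    by_cases hbx : b = x
    · -- entering `x` through an open edge from `a ∈ {p, h}`
      rw [hbx] at hends hne
      have hax : a ≠ x := hne
      have hxe : x ∈ ends e := by rw [hends]; exact Sym2.mem_mk_right _ _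
      rcases hm.edges e hxe with h1 | h1
      · rw [hends, Sym2.eq_iff] at h1
        rcases h1 with ⟨h2, -⟩ | ⟨h2, -⟩
        · exact absurd h2 hax
        · refine Or.inr ⟨hbx, e, by rw [hends, h2, Sym2.eq_swap], he, ?_⟩
          rcases ha' with ⟨-, ha''⟩ | ⟨hax', -⟩
          · rw [← h2]; exact ha''
          · exact absurd hax' hax
      · rw [hends, Sym2.eq_iff] at h1
        rcases h1 with ⟨h2, -⟩ | ⟨h2, -⟩
        · exact absurd h2 hax
        · exact absurd (h2 ▸ ha) hh
    · refine Or.inl ⟨hbx, ?_⟩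
      rcases ha' with ⟨hax, ha''⟩ | ⟨hax, e', he', hred', hp'⟩
      · exact mem_cluster_of_edge ha'' he (isolate_eq_of_ends_eq hax hbx hends)
      · -- leaving `x` through an open edge to `b ∈ {p, h}`
        rw [hax] at hends
        have hxe : x ∈ ends e := by rw [hends]; exact Sym2.mem_mk_left _ _
        rcases hm.edges e hxe with h1 | h1
        · rw [hends, Sym2.eq_iff] at h1
          rcases h1 with ⟨-, h2⟩ | ⟨-, h2⟩
          · rw [h2]; exact hp'
          · exact absurd h2 hbx
        · rw [hends, Sym2.eq_iff] at h1
          rcases h1 with ⟨-, h2⟩ | ⟨-, h2⟩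
          · exact absurd (h2 ▸ hb) hh
          · exact absurd h2 hbx
  constructor
  · intro w hw
    constructor
    · intro hw'
      rcases (hS hw').2 with ⟨-, h'⟩ | ⟨h', -⟩
      · exact h'
      · exact absurd h' hw
    · exact fun hw' => cluster_isolate_subset ζ v hw'
  · constructor
    · intro hx
      rcases (hS hx).2 with ⟨h', -⟩ | ⟨-, h'⟩
      · exact absurd rfl h'
      · exact h'
    · rintro ⟨e, he, hred, hp⟩
      exact mem_cluster_of_edge (cluster_isolate_subset ζ v hp) hred (ends_swap he)

/-- **The converse transport**: `h` is outside the cluster of `v ≠ x` in the graph as soon as it is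
outside it in the isolated graph and no red path `p–x–h` is attached to the cluster. -/
lemma IsHMarkAt.h_notMem_cluster_of_isolate {ζ : Config E} {v : V} (hv : v ≠ x)
    (hh' : h ∉ cluster (isolate ends x) ζ v)
    (hno : ¬ (p ∈ cluster (isolate ends x) ζ v ∧ (∃ e, ends e = s(x, p) ∧ ζ e = true) ∧
      ∃ g, ends g = s(x, h) ∧ ζ g = true)) :
    h ∉ cluster ends ζ v := by
  intro hhv
  have key : h ∈ {y | (y ≠ x ∧ y ∈ cluster (isolate ends x) ζ v) ∨
      (y = x ∧ ((∃ e, ends e = s(x, p) ∧ ζ e = true ∧ p ∈ cluster (isolate ends x) ζ v) ∨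
        (∃ g, ends g = s(x, h) ∧ ζ g = true ∧ h ∈ cluster (isolate ends x) ζ v)))} := by
    refine mem_of_conn_of_closed (ends := ends) (ω := ζ) ?_
      (Or.inl ⟨hv, mem_cluster_self _ _ _⟩) hhv
    rintro a ha b hab
    obtain ⟨hne, e, he, hends⟩ := openGraph_adj.1 hab
    by_cases hbx : b = x
    · rw [hbx] at hends hne
      have hax : a ≠ x := hne
      have hxe : x ∈ ends e := by rw [hends]; exact Sym2.mem_mk_right _ _
      have ha' : a ∈ cluster (isolate ends x) ζ v := by
        rcases ha with ⟨-, ha''⟩ | ⟨hax', -⟩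
        · exact ha''
        · exact absurd hax' hax
      rcases hm.edges e hxe with h1 | h1
      · rw [hends, Sym2.eq_iff] at h1
        rcases h1 with ⟨h2, -⟩ | ⟨h2, -⟩
        · exact absurd h2 hax
        · exact Or.inr ⟨hbx, Or.inl ⟨e, by rw [hends, h2, Sym2.eq_swap], he, h2 ▸ ha'⟩⟩
      · rw [hends, Sym2.eq_iff] at h1
        rcases h1 with ⟨h2, -⟩ | ⟨h2, -⟩
        · exact absurd h2 hax
        · exact Or.inr ⟨hbx, Or.inr ⟨e, by rw [hends, h2, Sym2.eq_swap], he, h2 ▸ ha'⟩⟩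
    · refine Or.inl ⟨hbx, ?_⟩
      rcases ha with ⟨hax, ha''⟩ | ⟨hax, hx'⟩
      · exact mem_cluster_of_edge ha'' he (isolate_eq_of_ends_eq hax hbx hends)
      · rw [hax] at hends
        have hxe : x ∈ ends e := by rw [hends]; exact Sym2.mem_mk_left _ _
        rcases hm.edges e hxe with h1 | h1
        · rw [hends, Sym2.eq_iff] at h1
          rcases h1 with ⟨-, h2⟩ | ⟨-, h2⟩
          · rw [h2]
            rcases hx' with ⟨-, -, -, hp'⟩ | ⟨-, -, -, hh''⟩
            · exact hp'
            · exact absurd hh'' hh'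
          · exact absurd h2 hbx
        · rw [hends, Sym2.eq_iff] at h1
          rcases h1 with ⟨-, h2⟩ | ⟨-, h2⟩
          · rw [h2]
            rcases hx' with ⟨e', he', hred', hp'⟩ | ⟨-, -, -, hh''⟩
            · exact absurd ⟨hp', ⟨e', he', hred'⟩, e, by rw [hends, h2], he⟩ hno
            · exact hh''
          · exact absurd h2 hbx
  rcases key with ⟨-, h'⟩ | ⟨h', -⟩
  · exact hh' h'
  · exact hm.xh h'.symm

end HMark

section Side

variable [Fintype E] [DecidableEq E]

variable {p h l : V} (hm : IsHMarkAt ends x p h) (hxl : x ≠ l)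
include hm hxl

/-- **The side of the H-mark** in terms of the isolated graph: `h ∉ H_l` there, some edge `x–p`
is red with `p ∈ C_R(l)`, every edge `x–h` is blue, and `p ∈ C_B(l)` forces every edge `x–p` red. -/
lemma IsHMarkAt.mem_tgt_iff {ζ : Config E} :
    ζ ∈ tgtU ends l h {S : Set V | x ∈ S} ↔
      h ∉ hull (isolate ends x) ζ l ∧ (∃ e, ends e = s(x, p) ∧ ζ e = true) ∧
        p ∈ cluster (isolate ends x) ζ l ∧ (∀ g, ends g = s(x, h) → ζ g = false) ∧
        (p ∈ cluster (isolate ends x) (blue ζ) l → ∀ e, ends e = s(x, p) → ζ e = true) := by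
  rw [LocRows.mem_tgt_iff]
  have hlx : l ≠ x := hxl.symm
  constructor
  · rintro ⟨hh, hxR, hxB⟩
    have hhR : h ∉ cluster ends ζ l := fun h' => hh (Or.inl h')
    have hhB : h ∉ cluster ends (blue ζ) l := fun h' => hh (Or.inr h')
    obtain ⟨e, he, hred, hpR⟩ := (hm.cluster_transport hlx hhR).2.1 hxR
    refine ⟨?_, ⟨e, he, hred⟩, hpR, ?_, ?_⟩
    · rintro (h1 | h1)
      · exact hhR (cluster_isolate_subset ζ l h1)
      · exact hhB (cluster_isolate_subset (blue ζ) l h1)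
    · intro g hg
      cases hζg : ζ g with
      | false => rfl
      | true => exact absurd (mem_cluster_of_edge hxR hζg hg) hhR
    · intro hpB e' he'
      cases hζe : ζ e' with
      | true => rfl
      | false =>
        exfalso
        have hpB' : p ∈ cluster ends (blue ζ) l := cluster_isolate_subset (blue ζ) l hpB
        exact hxB (mem_cluster_of_edge hpB' (blue_eq_true_iff.2 hζe) (ends_swap he'))
  · rintro ⟨hh', ⟨e, he, hred⟩, hpR, hg, hpB⟩
    have hhR : h ∉ cluster ends ζ l := by
      refine hm.h_notMem_cluster_of_isolate hlx (fun h' => hh' (Or.inl h')) ?_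
      rintro ⟨-, -, g, hg', hgred⟩
      rw [hg g hg'] at hgred
      exact Bool.noConfusion hgred
    have hhB : h ∉ cluster ends (blue ζ) l := by
      refine hm.h_notMem_cluster_of_isolate (ζ := blue ζ) hlx (fun h' => hh' (Or.inr h')) ?_
      rintro ⟨hpB', ⟨e', he', hblue⟩, -⟩
      rw [blue_apply, hpB hpB' e' he'] at hblue
      exact Bool.noConfusion hblue
    refine ⟨fun h1 => h1.elim hhR hhB, ?_, ?_⟩
    · exact mem_cluster_of_edge (cluster_isolate_subset ζ l hpR) hred (ends_swap he)
    · intro hxB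
      obtain ⟨e', he', hblue, hpB'⟩ := (hm.cluster_transport (ζ := blue ζ) hlx hhB).2.1 hxB
      rw [blue_apply, hpB hpB' e' he'] at hblue
      exact Bool.noConfusion hblue

omit hm hxl in
/-- On the side of the mark `x`, `x` is in no red cluster of `h`. -/
lemma x_notMem_cluster_h {ζ : Config E} (hζ : ζ ∈ tgtU ends l h {S : Set V | x ∈ S}) :
    x ∉ cluster ends ζ h := by
  rw [LocRows.mem_tgt_iff] at hζ
  exact notMem_cluster_h_of_mem_cluster_l hζ.1 hζ.2.1

omit hxl in
/-- **On the side of the H-mark the red edge set of `h` is that of the isolated graph.** -/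
lemma IsHMarkAt.redEdges_eq {ζ : Config E} (hζ : ζ ∈ tgtU ends l h {S : Set V | x ∈ S}) :
    redEdges ends ζ h = redEdges (isolate ends x) ζ h := by
  have hC : cluster ends ζ h = cluster (isolate ends x) ζ h :=
    cluster_eq_isolate_of_notMem (x_notMem_cluster_h hζ)
  ext e
  simp only [mem_redEdges]
  rw [hC, within_isolate_eq (x_notMem_cluster_isolate hm.xh.symm)]

end Side

end LocRows

end Summit.Ventures.PercRepro2
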